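import Literature.Analysis.SegalBargmann.SchwartzDualPairTorus
import HarnessLib

/-!
# The Weil representation of a compact group on `𝓢(ℝⁿ)`, CONSTRUCTED: `ω(h) = χ(h) • μ₀(ι h)|_𝓢` (Folland 1989, Prop. (4.39); Kashiwara–Vergne 1978)

Topic `Analysis/SegalBargmann`; namespace `Literature.Analysis.SegalBargmann`.  The files `SchwartzTorusIdentification`,
`SchwartzUnitaryIdentification`, `SchwartzDualPairTorus` proved that ANY Schwartz-level family which is
Heisenberg-covariant over a compact `ι : H →* U(σ)` and lifts to unitaries is `vacCoeff • μ₀(ι ·)|_𝓢`.  This file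
CONSTRUCTS the family: for a homomorphism `ι : H →* U(σ)` and a unitary character `χ : H →* S¹`,

  `compactWeilRep ι χ : Representation ℂ H 𝓢(ℝ^σ, ℂ)`,  `compactWeilRep ι χ h f = χ h • unitaryOpPi (ι h) f`,

a genuine REPRESENTATION (group law from `unitaryOpPi_one/_mul`) with

* §1 unit scalars as isometries (`circleSmulLIE`), the unitary lifts `compactWeilLift ι χ h = χ h • μ₀(ι h)`
  (`liftsTo_compactWeilRep`), vacuum expectation `vacCoeff (compactWeilLift ι χ) h = χ h`;
* §2 **Heisenberg covariance ON `𝓢`**: `isRhoCovariantS_compactWeilRep : IsRhoCovariantS ι (compactWeilRep ι χ ·)`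
  (from the tree's `schrodingerU_rho'` through `toL2`-injectivity; a general lemma `isRhoCovariantS_of_toL2_eq_smul`);
* §3 the EXPLICIT action: Hermite expansion `compactWeilRep_hermitePi`, torus weights
  `compactWeilRep_hermitePi_of_diag : ι h = diag t → ω h h_α = (χ h · torusChar α t) • h_α`, the Gaussian
  `compactWeilRep_hermitePi_zero : ω h h_0 = χ h • h_0`;
* §4 **strong and joint continuity into the Schwartz topology** from continuity of `ι` and `χ`
  (`continuous_compactWeilRep_apply/_uncurry`);
* §5 UNIQUENESS: every covariant Schwartz-level family with multiplicative unitary lifts IS `compactWeilRep ι vacChar`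
  (`IsRhoCovariantS.eq_compactWeilRep_vacChar`);
* §6 the compact dual pair `(U(P)×U(Q))×(U(R)×U(S))`: `dualPairWeilRep χ := compactWeilRep dualPairι χ`, weights on its
  torus and on the two centres (`dualPairWeilRep_hermitePi_torus/_scalarW/_scalarV`), continuity.

So at a place where BOTH members of a reductive dual pair are compact (`U(p) × U(r)`), the archimedean Weil
representation on the Schwartz space is an explicit kernel object, determined up to — and parametrised by — the
character `χ` (and at any place its restriction to a compact subgroup is); the only datum a cited source has to supply
is WHICH `χ` a given normalisation (splitting characters) produces.  Everything is proved from Mathlib and the imported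
tree files; no cited statement is used as a hypothesis.

## References

* [Folland1989] G. B. Folland, *Harmonic Analysis in Phase Space*, Princeton UP (1989), §4.2 (4.23), Prop. (4.39),
  Ch. 4 §5.  [cite: Folland1989, Prop (4.39)]
* M. Kashiwara, M. Vergne, Invent. Math. 44 (1978) 1–47, §II (the Fock model of `U(p) × U(r)`).

## Provenance

LEAN-IN-TREE rule (2026-08-18), pub-hodgecm model-construction sub-cell, seat mc-binder-2 gen 2 ("γ3-compact": rows
A12/A34 and the Γ1a clause of hch — the whole pair at the places of kind `D₁₂` (`(U(2), U(3))`, both compact), and the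
compact tori / maximal compact subgroups at the places of kind `Σ₁₂` (`(U(1,1), U(3))`) and `ι₁` (`(U(2), U(2,1))`)).
-/

set_option autoImplicit false

noncomputable section

open MeasureTheory Complex SchwartzMap Filter Topology
open scoped InnerProductSpace ComplexConjugate Real BigOperators

namespace Literature.Analysis.SegalBargmann

variable {σ : Type*} [Fintype σ] [DecidableEq σ]

local notation "L2R" σ => Lp ℂ 2 (volume : Measure (σ → ℝ))
local notation "SR" σ => SchwartzMap (σ → ℝ) ℂ

/-! ## §1  Unit scalars, the representation, its lifts -/

section Construction

/-- **Multiplication by `c ∈ S¹` as a linear isometry equivalence** of a complex normed space. [folklore] -/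
def circleSmulLIE (E : Type*) [NormedAddCommGroup E] [NormedSpace ℂ E] (c : Circle) : E ≃ₗᵢ[ℂ] E where
  toLinearEquiv := LinearEquiv.smulOfUnit (Circle.toUnits c)
  norm_map' x := by
    change ‖((Circle.toUnits c : ℂˣ) : ℂ) • x‖ = ‖x‖
    rw [Circle.toUnits_apply, Units.val_mk0, norm_smul, Circle.norm_coe, one_mul]

omit [Fintype σ] [DecidableEq σ] in
/-- Unfolding: `circleSmulLIE E c x = c • x`. [folklore] -/
@[simp] theorem circleSmulLIE_apply {E : Type*} [NormedAddCommGroup E] [NormedSpace ℂ E] (c : Circle) (x : E) :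
    circleSmulLIE E c x = ((c : Circle) : ℂ) • x := rfl

variable {H : Type*} [Group H]

/-- **The Weil representation of a compact group on `𝓢(ℝ^σ, ℂ)`** attached to `ι : H →* U(σ)` and a unitary character
`χ : H →* S¹`: `ω(h) := χ(h) • μ₀(ι h)|_𝓢`.  A genuine representation (`unitaryOpPi_one/_mul`).
[cite: Folland1989, Prop (4.39)] -/
def compactWeilRep (ι : H →* Matrix.unitaryGroup σ ℂ) (χ : H →* Circle) : Representation ℂ H (SR σ) where
  toFun h := ((χ h : Circle) : ℂ) • ((unitaryOpPi (ι h) : (SR σ) →L[ℂ] SR σ) : (SR σ) →ₗ[ℂ] SR σ)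
  map_one' := by
    apply LinearMap.ext
    intro f
    simp only [map_one, unitaryOpPi_one, Circle.coe_one, one_smul]
    rfl
  map_mul' h h' := by
    apply LinearMap.ext
    intro f
    simp only [map_mul, Circle.coe_mul, LinearMap.smul_apply, ContinuousLinearMap.coe_coe, unitaryOpPi_mul,
      ContinuousLinearMap.comp_apply, Module.End.mul_apply, map_smul, smul_smul, mul_comm]

variable (ι : H →* Matrix.unitaryGroup σ ℂ) (χ : H →* Circle)

/-- Unfolding: `compactWeilRep ι χ h f = χ h • unitaryOpPi (ι h) f`. [cite: Folland1989, Prop (4.39)] -/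
@[simp] theorem compactWeilRep_apply (h : H) (f : SR σ) :
    compactWeilRep ι χ h f = ((χ h : Circle) : ℂ) • unitaryOpPi (ι h) f := rfl

/-- Inside `L²`: `toL2 (ω h f) = χ h • μ₀(ι h) (toL2 f)`. [cite: Folland1989, Prop (4.39)] -/
theorem toL2_compactWeilRep (h : H) (f : SR σ) :
    toL2 (compactWeilRep ι χ h f) = ((χ h : Circle) : ℂ) • schrodingerU (ι h) (toL2 f) := by
  rw [compactWeilRep_apply, map_smul, toL2_unitaryOpPi]

/-- **The unitary lifts** `χ h • μ₀(ι h)` on `L²(ℝ^σ)`. [cite: Folland1989, Prop (4.39)] -/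
def compactWeilLift (h : H) : (L2R σ) ≃ₗᵢ[ℂ] L2R σ :=
  (schrodingerU (ι h)).trans (circleSmulLIE (L2R σ) (χ h))

/-- Unfolding: `compactWeilLift ι χ h g = χ h • μ₀(ι h) g`. [folklore] -/
@[simp] theorem compactWeilLift_apply (h : H) (g : L2R σ) :
    compactWeilLift ι χ h g = ((χ h : Circle) : ℂ) • schrodingerU (ι h) g := rfl

/-- `ω h` on `𝓢` is the restriction of the unitary `compactWeilLift ι χ h`. [cite: Folland1989, Prop (4.39)] -/
theorem liftsTo_compactWeilRep (h : H) : LiftsTo (compactWeilRep ι χ h) (liftCLM (compactWeilLift ι χ) h) :=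
  fun f => by rw [liftCLM_apply, compactWeilLift_apply, toL2_compactWeilRep]

/-- The lift family is multiplicative. [folklore] -/
theorem compactWeilLift_mul (h h' : H) (g : L2R σ) :
    compactWeilLift ι χ (h * h') g = compactWeilLift ι χ h (compactWeilLift ι χ h' g) := by
  simp only [compactWeilLift_apply, map_mul, Circle.coe_mul, schrodingerU_mul, map_smul, smul_smul, mul_comm]

/-- The lift family at the identity. [folklore] -/
theorem compactWeilLift_one (g : L2R σ) : compactWeilLift ι χ 1 g = g := by
  simp only [compactWeilLift_apply, map_one, Circle.coe_one, one_smul, schrodingerU_one]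

/-- **The vacuum expectation of the lift is the character**: `⟨k_0, χ h μ₀(ι h) k_0⟩ = χ h`. [folklore] -/
theorem vacCoeff_compactWeilLift (h : H) : vacCoeff (compactWeilLift ι χ) h = ((χ h : Circle) : ℂ) := by
  rw [vacCoeff_apply, compactWeilLift_apply, schrodingerU_vacL2, inner_smul_right, inner_vacL2_self, mul_one]

end Construction

/-! ## §2  Heisenberg covariance on `𝓢` -/

section Covariance

variable {H : Type*}

/-- **Covariance transfers DOWN from `L²`**: a Schwartz-level family whose `toL2`-image is `c h • μ₀(ι h) ∘ toL2` is
Heisenberg-covariant over `ι` on `𝓢` (the tree's `schrodingerU_rho'` + `toL2`-injectivity). [cite: Folland1989, §4.2, (4.23)] -/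
theorem isRhoCovariantS_of_toL2_eq_smul {ι : H → Matrix.unitaryGroup σ ℂ} {ωS : H → ((SR σ) →ₗ[ℂ] SR σ)}
    (c : H → ℂ) (hω : ∀ h f, toL2 (ωS h f) = c h • schrodingerU (ι h) (toL2 f)) : IsRhoCovariantS ι ωS := by
  intro h p q f
  apply toL2_injective
  rw [hω, toL2_rhoS, schrodingerU_rho', toL2_rhoS, hω, map_smul]
  rfl

variable [Group H] (ι : H →* Matrix.unitaryGroup σ ℂ) (χ : H →* Circle)

/-- **`compactWeilRep ι χ` is Heisenberg-covariant over `ι` on `𝓢(ℝ^σ)`.** [cite: Folland1989, §4.2, (4.23)] -/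
theorem isRhoCovariantS_compactWeilRep : IsRhoCovariantS ι (fun h => compactWeilRep ι χ h) :=
  isRhoCovariantS_of_toL2_eq_smul (fun h => ((χ h : Circle) : ℂ)) (toL2_compactWeilRep ι χ)

/-- … and its lifts are covariant unitaries on `L²`. [cite: Folland1989, §4.2, (4.23)] -/
theorem isRhoCovariant_compactWeilLift : IsRhoCovariant ι (compactWeilLift ι χ) :=
  (isRhoCovariantS_compactWeilRep ι χ).lift (liftsTo_compactWeilRep ι χ)

end Covariance

/-! ## §3  The explicit action -/

section Action

variable {H : Type*} [Group H] (ι : H →* Matrix.unitaryGroup σ ℂ) (χ : H →* Circle)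

/-- `μ₀(U)` fixes the Gaussian on `𝓢`: `unitaryOpPi U h_0 = h_0`. [cite: Folland1989, Prop (4.39)] -/
theorem unitaryOpPi_hermitePi_zero (U : Matrix.unitaryGroup σ ℂ) : unitaryOpPi U (hermitePi 0) = hermitePi 0 := by
  apply toL2_injective
  rw [toL2_unitaryOpPi, toL2_hermitePi_zero, schrodingerU_vacL2]

/-- **Hermite expansion of the action**: `ω h h_β = χ h • Σ_{|α| ≤ |β|} uKernel (ι h) α β • h_α`. [cite: Folland1989, Prop (4.39)] -/
theorem compactWeilRep_hermitePi (h : H) (β : σ →₀ ℕ) :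
    compactWeilRep ι χ h (hermitePi β) =
      ((χ h : Circle) : ℂ) • ∑ α ∈ degLE β.degree, uKernel (ι h) α β • hermitePi α := by
  rw [compactWeilRep_apply, unitaryOpPi_hermitePi]

/-- **Torus weights**: if `ι h = diag t` then `ω h h_α = (χ h · torusChar α t) • h_α`. [cite: Folland1989, §1.7] -/
theorem compactWeilRep_hermitePi_of_diag {h : H} {t : σ → Circle} (ht : ι h = diagHom t) (α : σ →₀ ℕ) :
    compactWeilRep ι χ h (hermitePi α) = (((χ h : Circle) : ℂ) * torusChar α t) • hermitePi α := by
  rw [compactWeilRep_apply, ht, ← torusPt_torusAngle t, unitaryOpPi_diagHom_torusPt, torusOpPi_hermitePi,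
    torusChar_torusPt, smul_smul]

/-- **The Gaussian**: `ω h h_0 = χ h • h_0` — the character is read off on the vacuum. [cite: Folland1989, §1.7] -/
theorem compactWeilRep_hermitePi_zero (h : H) :
    compactWeilRep ι χ h (hermitePi 0) = ((χ h : Circle) : ℂ) • hermitePi 0 := by
  rw [compactWeilRep_apply, unitaryOpPi_hermitePi_zero]

end Action

/-! ## §4  Continuity into the Schwartz topology -/

section Continuity

variable {H : Type*} [Group H] [TopologicalSpace H] {ι : H →* Matrix.unitaryGroup σ ℂ} {χ : H →* Circle}

/-- **Strong continuity**: `h ↦ ω h f` is continuous into `𝓢(ℝ^σ, ℂ)` when `ι` and `χ` are continuous.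
[cite: Folland1989, Prop (4.39)] -/
theorem continuous_compactWeilRep_apply (hι : Continuous ι) (hχ : Continuous χ) (f : SR σ) :
    Continuous fun h => compactWeilRep ι χ h f := by
  simp only [compactWeilRep_apply]
  exact (continuous_subtype_val.comp hχ).smul ((continuous_unitaryOpPi_apply f).comp hι)

/-- **Joint continuity** `(h, f) ↦ ω h f`. [cite: Folland1989, Prop (4.39)] -/
theorem continuous_compactWeilRep_uncurry (hι : Continuous ι) (hχ : Continuous χ) :
    Continuous fun p : H × (SR σ) => compactWeilRep ι χ p.1 p.2 := by
  simp only [compactWeilRep_apply]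
  have h2 : Continuous fun p : H × (SR σ) => (ι p.1, p.2) := (hι.comp continuous_fst).prodMk continuous_snd
  exact ((continuous_subtype_val.comp hχ).comp continuous_fst).smul
    (continuous_unitaryOpPi_uncurry.comp (f := fun p : H × (SR σ) => (ι p.1, p.2)) h2)

/-- The lifts have continuous orbit maps in `L²` as well. [folklore] -/
theorem continuous_compactWeilLift_apply (hι : Continuous ι) (hχ : Continuous χ) (g : L2R σ) :
    Continuous fun h => compactWeilLift ι χ h g := by
  simp only [compactWeilLift_apply]
  exact (continuous_subtype_val.comp hχ).smul ((continuous_schrodingerU_apply g).comp hι)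

end Continuity

/-! ## §5  Uniqueness: every covariant Schwartz-level family is a `compactWeilRep` -/

section Uniqueness

variable {H : Type*} [Group H] {ι : H →* Matrix.unitaryGroup σ ℂ} {ωS : H → ((SR σ) →ₗ[ℂ] SR σ)}
  {ω : H → ((L2R σ) ≃ₗᵢ[ℂ] L2R σ)}

/-- **Uniqueness of the compact Weil representation on `𝓢`.**  A Schwartz-level family covariant over `ι` whose
unitary lifts form a representation (`ω 1 = 1`, `ω (hh′) = ω h ∘ ω h′`) IS `compactWeilRep ι vacChar`:
`ωS h f = compactWeilRep ι (vacChar …) h f`, `vacChar` the vacuum character of the rigidity lane.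
[cite: Folland1989, §4.2, (4.23) and the Schur remark following it] -/
theorem IsRhoCovariantS.eq_compactWeilRep_vacChar (hS : IsRhoCovariantS ι ωS)
    (hlift : ∀ h, LiftsTo (ωS h) (liftCLM ω h)) (hω1 : ∀ g : L2R σ, ω 1 g = g)
    (hωm : ∀ (h h' : H) (g : L2R σ), ω (h * h') g = ω h (ω h' g)) (h : H) (f : SR σ) :
    ωS h f = compactWeilRep ι (vacChar (hS.lift hlift) hω1 hωm) h f := by
  rw [compactWeilRep_apply, coe_vacChar, hS.apply_eq_vacCoeff_smul_unitaryOpPi hlift]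

end Uniqueness

/-! ## §6  The compact dual pair -/

section DualPair

variable {P Q R S : Type*} [Fintype P] [DecidableEq P] [Fintype Q] [DecidableEq Q] [Fintype R] [DecidableEq R]
  [Fintype S] [DecidableEq S]

/-- **The Weil representation of the compact dual pair `(U(P)×U(Q)) × (U(R)×U(S))` on `𝓢(ℝ^{DPIdx})` with character
`χ`**: `dualPairWeilRep χ := compactWeilRep dualPairι χ`. [cite: Folland1989, Prop (4.39)] -/
def dualPairWeilRep (χ : DPK P Q R S →* Circle) :
    Representation ℂ (DPK P Q R S) (SchwartzMap (DPIdx P Q R S → ℝ) ℂ) :=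
  compactWeilRep dualPairι χ

variable (χ : DPK P Q R S →* Circle)

/-- Unfolding. [folklore] -/
theorem dualPairWeilRep_apply (k : DPK P Q R S) (f : SchwartzMap (DPIdx P Q R S → ℝ) ℂ) :
    dualPairWeilRep χ k f = ((χ k : Circle) : ℂ) • unitaryOpPi (dualPairι k) f := rfl

/-- **Weights on the dual-pair torus**: `ω(diag α, diag β, diag γ, diag δ) h_m = (χ · torusChar m (dpTorus α β γ δ)) • h_m`.
[cite: Folland1989, Prop (4.39)] -/
theorem dualPairWeilRep_hermitePi_torus (α : P → Circle) (β : Q → Circle) (γ : R → Circle) (δ : S → Circle)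
    (m : DPIdx P Q R S →₀ ℕ) :
    dualPairWeilRep χ ((diagHom α, diagHom β), (diagHom γ, diagHom δ)) (hermitePi m) =
      (((χ ((diagHom α, diagHom β), (diagHom γ, diagHom δ)) : Circle) : ℂ) * torusChar m (dpTorus α β γ δ)) •
        hermitePi m :=
  compactWeilRep_hermitePi_of_diag dualPairι χ (dualPairι_diagHom α β γ δ) m

/-- **The centre of `U(W)`** acts on `h_m` by `χ · t^{deg_{PR} m + deg_{QS} m} · t̄^{deg_{PS} m + deg_{QR} m}`.
[cite: Folland1989, Prop (4.39)] -/
theorem dualPairWeilRep_hermitePi_scalarW (t : Circle) (m : DPIdx P Q R S →₀ ℕ) :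
    dualPairWeilRep χ ((diagHom fun _ : P => (1 : Circle), diagHom fun _ : Q => (1 : Circle)),
        (diagHom fun _ : R => t, diagHom fun _ : S => t)) (hermitePi m) =
      (((χ ((diagHom fun _ : P => (1 : Circle), diagHom fun _ : Q => (1 : Circle)),
          (diagHom fun _ : R => t, diagHom fun _ : S => t)) : Circle) : ℂ) *
        (((t : Circle) : ℂ) ^ (degPR m + degQS m) * conj ((t : Circle) : ℂ) ^ (degPS m + degQR m))) •
        hermitePi m := by
  rw [dualPairWeilRep_hermitePi_torus, torusChar_dpTorus_scalarW]

/-- **The centre of `U(V)`** acts on `h_m` by the same polynomial weight. [cite: Folland1989, Prop (4.39)] -/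
theorem dualPairWeilRep_hermitePi_scalarV (t : Circle) (m : DPIdx P Q R S →₀ ℕ) :
    dualPairWeilRep χ ((diagHom fun _ : P => t, diagHom fun _ : Q => t),
        (diagHom fun _ : R => (1 : Circle), diagHom fun _ : S => (1 : Circle))) (hermitePi m) =
      (((χ ((diagHom fun _ : P => t, diagHom fun _ : Q => t),
          (diagHom fun _ : R => (1 : Circle), diagHom fun _ : S => (1 : Circle))) : Circle) : ℂ) *
        (((t : Circle) : ℂ) ^ (degPR m + degQS m) * conj ((t : Circle) : ℂ) ^ (degPS m + degQR m))) •
        hermitePi m := by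
  rw [dualPairWeilRep_hermitePi_torus, torusChar_dpTorus_scalarV]

/-- The Gaussian: `ω k h_0 = χ k • h_0`. [cite: Folland1989, §1.7] -/
theorem dualPairWeilRep_hermitePi_zero (k : DPK P Q R S) :
    dualPairWeilRep χ k (hermitePi 0) = ((χ k : Circle) : ℂ) • hermitePi 0 :=
  compactWeilRep_hermitePi_zero dualPairι χ k

/-- Heisenberg covariance over the block datum `dualPairι`. [cite: Folland1989, §4.2, (4.23)] -/
theorem isRhoCovariantS_dualPairWeilRep : IsRhoCovariantS (fun k => dualPairι k) (fun k => dualPairWeilRep χ k) :=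
  isRhoCovariantS_compactWeilRep dualPairι χ

/-- **Continuity** of `k ↦ ω k f` into `𝓢` for a continuous character `χ`. [cite: Folland1989, Prop (4.39)] -/
theorem continuous_dualPairWeilRep_apply (hχ : Continuous χ) (f : SchwartzMap (DPIdx P Q R S → ℝ) ℂ) :
    Continuous fun k => dualPairWeilRep χ k f :=
  continuous_compactWeilRep_apply continuous_dualPairι hχ f

/-- Joint continuity `(k, f) ↦ ω k f`. [cite: Folland1989, Prop (4.39)] -/
theorem continuous_dualPairWeilRep_uncurry (hχ : Continuous χ) :
    Continuous fun p : DPK P Q R S × SchwartzMap (DPIdx P Q R S → ℝ) ℂ => dualPairWeilRep χ p.1 p.2 :=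
  continuous_compactWeilRep_uncurry continuous_dualPairι hχ

end DualPair

end Literature.Analysis.SegalBargmann
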